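import Summits.MatrixMultiplication.MatrixMultiplication.Theorems.EdgePencilFlatSummandListPrice
import HarnessLib

/-!
# The edge profile of a 4-party spectral point on the pencil `e ↦ [W_n^{(e)}]`, and the
# BLIND-OR-FLAT law: the flat-summand purchase forces every spectral point that sees the doubling
# of the thin edge to value the diamond at most `n⁴`

Support kernel for `stmt-MatrixMultiplication-26697` (`TetraExcessZero`, route `TetrahedronCarving`; cut of
record `closes (TetraExcessZero) (TetraPlusTwo) : ω = 2`, UNCHANGED; lineage `decomp-mm-lens-6`, generation 43).
No item is added or changed; no definition is introduced. Notation as in `EdgePencilFlatSummandGauge(Laws)`,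
`EdgePencilFlatSummandListPrice`: `W_n^{(e)} = sixTetra F n e`, `D_n = W_n^{(1)}`, `T₄(F) = DTensorClass F 4`,
`X₄(F) = DTensorClass.asymptoticSpectrumDTensors F 2` (Strassen's asymptotic spectrum of 4-tensors),
`[t] = DTensorClass.mk t`, `≲ = AsympLe (· ≤ ·)`; the purchase of record is
`RUNG♭(δ, n) : [W_n^{(⌈n^δ⌉)}] ≲ [D_n] + n⁴`.

§9 THE EDGE PROFILE. For `φ ∈ X₄(F)` the thickening ratio `p_φ(e) = φ[W_n^{(e)}] / φ[D_n]` of the thin edge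
obeys, as theorems over the tree's classes (no quotient is formed; everything is stated multiplied out):
`1 ≤ φ[D_n] ≤ φ[W_n^{(e)}] ≤ e·φ[D_n]` (`one_le_spectrum_sixTetra`, `spectrum_diamond_le_sixTetra`,
`spectrum_sixTetra_le_mul_diamond` — the last from the list-price restriction `[W_n^{(e)}] ≤ e·[D_n]`), and
it is MULTIPLICATIVE: `φ[W_n^{(ee')}]·φ[D_n] = φ[W_n^{(e)}]·φ[W_n^{(e')}]` (`spectrum_sixTetra_mul_diamond`,
`ee' ≤ n`; both sides are `φ[W_{n²}^{(ee')}]` by `EdgePencilFlatSummand.mk_sixTetra_mul`), with powers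
`φ[W_n^{(e)}]^{k+1} = φ[W_{n^{k+1}}^{(e^{k+1})}]` (`spectrum_sixTetra_pow`). So along the levels `n^{k+1}` a
point either is BLIND to the thin edge (`φ[W_n^{(2)}] = φ[D_n]`, hence at every power) or sees its doubling
with a ratio `r > 1` that grows like `r^{k+1}`.

§10 BLIND OR FLAT. A purchase `[W_N^{(E)}] ≲ [D_N] + m` read at `φ` is `φ[W] ≤ φ[D] + m`, so
`φ[D_N] ≤ m ∨ φ[W_N^{(E)}] < 2·φ[D_N]` (`flat_or_lt_two_mul_of_purchase`). Feeding the levels `N = n^{k+1}`,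
`E = 2^{k+1}` and the growth `r^{k+1} → ∞`:

* `blind_or_flat` — if `[W_{n^{k+1}}^{(2^{k+1})}] ≲ [D_{n^{k+1}}] + n^{4(k+1)}` for infinitely many `k`, then
  EVERY `φ ∈ X₄(F)` has **`φ[W_n^{(2)}] = φ[D_n]` (blind) or `φ[D_n] ≤ n⁴` (flat)**;
* `blind_or_flat_of_flatPurchase` — the same from `RUNG♭(δ, n^{k+1})` at infinitely many `k`, for ANY
  `δ` with `2 ≤ n^δ`: the falsifiable content of the purchase of record does not depend on `δ` inside the
  window of record (only its price `χ(δ) ≤ ψ` does);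
* `blind_or_flat_of_matrixMultiplication` — under `ω = 2` (NEC anchor, through
  `EdgePencilFlatSummandPrice.flatPurchase_of_matrixMultiplication`);
* `not_flatPurchase_of_seeing_nonflat_point` — **THE KILL TEST OF RECORD, RE-TYPED**: one point
  `φ ∈ X₄(F)` and one level `n ≥ 2` with `φ[W_n^{(2)}] ≠ φ[D_n]` and `n⁴ < φ[D_n]` refute `RUNG♭(δ, ·)` along
  the powers of `n` (no evaluation of `φ` on `W_n^{(⌈n^δ⌉)}` or on `D ⊕ ⟨n⁴⟩` is needed). Every point in the
  screen of record is flat on the diamond (`ζ^{(S)}[D_n] ≤ n⁴`, upper support / quantum functionals `≤ n³`),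
  which is why none of them kills; a killing point values the diamond above its largest flattening — so it
  alone certifies `R̃(D_n) > n⁴`, i.e. `ψ = ω(2,1,2) > 4` (`¬HalfAlpha`) — AND sees one more copy of the
  missing edge (`φ[W_n^{(2)}] > φ[D_n]`).

References: Strassen 1988 (asymptotic spectrum; spectral characterisation of `≲`) [Strassen1988]; Zuiddam
2018, Def. 2.1, Thm. 2.12, Cor. 2.13 [Zuiddam2018]; Christandl–Vrana–Zuiddam 2023, Thm. 1.1, Prop. 1.6
[ChristandlVranaZuiddam2023]; Christandl–Vrana–Zuiddam, arXiv:1609.07476, Ex. 1.1.2 [ChristandlVranaZuiddam2016];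
Alman–Li–Pratt 2026, §3.2.2 (the explicitly known 4-party points: quantum functionals and grouped lower-order
points) [arXiv:2604.01386].
No `sorry`, no new axiom, no instance, no notation, no definition.
-/

noncomputable section

set_option linter.dupNamespace false

open Finset Literature.Computability.AlgebraicComplexity
open Summit.MatrixMultiplication.MatrixMultiplication.Theorems.TetrahedronTensor
open Summit.MatrixMultiplication.MatrixMultiplication.Theorems.TetraDiagonal
open Summit.MatrixMultiplication.MatrixMultiplication.Theses.TetrahedronCarving

namespace Summit.MatrixMultiplication.MatrixMultiplication.Theorems.EdgePencil

/-! ## §9 The edge profile of a spectral point on the pencil -/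

section Profile

variable {F : Type*} [Field F]

/-- `W_n^{(e)} ≥ ⟨1⟩`: the pencil tensors are non-zero classes (`1 ≤ e`, `1 ≤ n`; restrict to the entry at
the all-zero labels). [cite: ChristandlVranaZuiddam2023, §1.2] -/
theorem one_le_mk_sixTetra {n e : ℕ} (hn : 1 ≤ n) (he : 1 ≤ e) :
    (1 : DTensorClass F 4) ≤ DTensorClass.mk (sixTetra F n e) := by
  classical
  haveI : NeZero n := NeZero.of_pos hn
  have h1 : (1 : DTensorClass F 4) = DTensorClass.mk (DTensor.unit F 4 (Fin 1)) := by
    rw [← Nat.cast_one, DTensorClass.natCast_eq_mk]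
  rw [h1, DTensorClass.mk_le_mk_iff]
  have h := DTensor.restricts_precomp (fun _ : Fin 1 => enc (0 : Fin n) 0 0) (sixTetra F n e)
  have hval : sixTetra F n e (fun _ : Fin 4 => enc (0 : Fin n) 0 0) = 1 := by
    rw [sixTetra_apply]
    simp [ind, (show e ≠ 0 by omega)]
  have hfun : (fun i : Fin 4 → Fin 1 => sixTetra F n e (fun j => (fun _ : Fin 1 => enc (0 : Fin n) 0 0) (i j)))
      = DTensor.unit F 4 (Fin 1) := by
    funext i
    rw [DTensor.unit_apply, if_pos (fun j j' => Subsingleton.elim _ _)]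
    exact hval
  rw [hfun] at h
  exact h

/-- `1 ≤ φ[W_n^{(e)}]` for every spectral point (`1 ≤ e`, `1 ≤ n`). [cite: Zuiddam2018, Def. 2.11] -/
theorem one_le_spectrum_sixTetra {n e : ℕ} (hn : 1 ≤ n) (he : 1 ≤ e) {φ : DTensorClass F 4 → ℝ}
    (hφ : φ ∈ DTensorClass.asymptoticSpectrumDTensors F 2) :
    1 ≤ φ (DTensorClass.mk (sixTetra F n e)) := by
  have hφ' := DTensorClass.mem_asymptoticSpectrumDTensors_iff.1 hφ
  have := hφ'.mono (one_le_mk_sixTetra (F := F) hn he)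
  rwa [hφ'.map_one] at this

/-- **Lower edge of the profile**: `φ[D_n] ≤ φ[W_n^{(e)}]` (`1 ≤ e`). [cite: Zuiddam2018, Def. 2.11] -/
theorem spectrum_diamond_le_sixTetra {n e : ℕ} (he : 1 ≤ e) {φ : DTensorClass F 4 → ℝ}
    (hφ : φ ∈ DTensorClass.asymptoticSpectrumDTensors F 2) :
    φ (DTensorClass.mk (sixTetra F n 1)) ≤ φ (DTensorClass.mk (sixTetra F n e)) :=
  (DTensorClass.mem_asymptoticSpectrumDTensors_iff.1 hφ).mono (mk_sixTetra_mono he)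

/-- **Upper edge of the profile (list price)**: `φ[W_n^{(e)}] ≤ e·φ[D_n]` (`1 ≤ n`).
[cite: Zuiddam2018, Def. 2.11] -/
theorem spectrum_sixTetra_le_mul_diamond {n : ℕ} (hn : 1 ≤ n) (e : ℕ) {φ : DTensorClass F 4 → ℝ}
    (hφ : φ ∈ DTensorClass.asymptoticSpectrumDTensors F 2) :
    φ (DTensorClass.mk (sixTetra F n e)) ≤ e * φ (DTensorClass.mk (sixTetra F n 1)) := by
  have hφ' := DTensorClass.mem_asymptoticSpectrumDTensors_iff.1 hφ
  have := hφ'.mono (mk_sixTetra_le_natCast_mul_diamond (F := F) hn e)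
  rwa [hφ'.map_mul, hφ'.map_natCast] at this

/-- **The profile is multiplicative**: `φ[W_n^{(ee')}]·φ[D_n] = φ[W_n^{(e)}]·φ[W_n^{(e')}]` (`e, e' ≤ n`,
`e·e' ≤ n`): both sides are `φ[W_{n²}^{(ee')}]` by `mk_sixTetra_mul`. [cite: ChristandlVranaZuiddam2023, §1.2] -/
theorem spectrum_sixTetra_mul_diamond {n e e' : ℕ} (hn : 1 ≤ n) (he : e ≤ n) (he' : e' ≤ n)
    (hee' : e * e' ≤ n) {φ : DTensorClass F 4 → ℝ} (hφ : φ ∈ DTensorClass.asymptoticSpectrumDTensors F 2) :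
    φ (DTensorClass.mk (sixTetra F n (e * e'))) * φ (DTensorClass.mk (sixTetra F n 1)) =
      φ (DTensorClass.mk (sixTetra F n e)) * φ (DTensorClass.mk (sixTetra F n e')) := by
  have hφ' := DTensorClass.mem_asymptoticSpectrumDTensors_iff.1 hφ
  rw [← hφ'.map_mul, ← hφ'.map_mul, mk_sixTetra_mul (F := F) hee' hn, mk_sixTetra_mul (F := F) he he',
    mk_sixTetra_congr rfl (mul_one (e * e'))]

/-- **Powers of the profile are levels**: `φ[W_n^{(e)}]^{k+1} = φ[W_{n^{k+1}}^{(e^{k+1})}]` (`e ≤ n`).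
[cite: ChristandlVranaZuiddam2023, §1.2] -/
theorem spectrum_sixTetra_pow {n e : ℕ} (he : e ≤ n) (k : ℕ) {φ : DTensorClass F 4 → ℝ}
    (hφ : φ ∈ DTensorClass.asymptoticSpectrumDTensors F 2) :
    φ (DTensorClass.mk (sixTetra F n e)) ^ (k + 1) =
      φ (DTensorClass.mk (sixTetra F (n ^ (k + 1)) (e ^ (k + 1)))) := by
  have hφ' := DTensorClass.mem_asymptoticSpectrumDTensors_iff.1 hφ
  rw [← hφ'.map_pow, mk_sixTetra_pow (F := F) he k]

end Profile

/-! ## §10 Blind or flat -/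

section BlindOrFlat

variable {F : Type*} [Field F]

/-- **A purchase read at one point is a dichotomy**: `[W] ≲ [D] + m` gives, at every `φ ∈ X₄(F)`,
`φ[D] ≤ m` or `φ[W] < 2·φ[D]`. [cite: Strassen1988, Thm. (spectral characterisation)] -/
theorem flat_or_lt_two_mul_of_purchase {N E m : ℕ}
    (h : AsympLe (fun x y : DTensorClass F 4 => x ≤ y) (DTensorClass.mk (sixTetra F N E))
      (DTensorClass.mk (sixTetra F N 1) + (m : DTensorClass F 4)))
    {φ : DTensorClass F 4 → ℝ} (hφ : φ ∈ DTensorClass.asymptoticSpectrumDTensors F 2) :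
    φ (DTensorClass.mk (sixTetra F N 1)) ≤ m ∨
      φ (DTensorClass.mk (sixTetra F N E)) < 2 * φ (DTensorClass.mk (sixTetra F N 1)) := by
  have hφ' := DTensorClass.mem_asymptoticSpectrumDTensors_iff.1 hφ
  have key := (DTensorClass.asympLe_iff_forall_mem_spectrum.1 h) φ hφ
  rw [hφ'.map_add, hφ'.map_natCast] at key
  by_cases hm : φ (DTensorClass.mk (sixTetra F N 1)) ≤ m
  · exact Or.inl hm
  · right
    linarith [lt_of_not_ge hm]

/-- **BLIND OR FLAT.** If the doubled-edge purchase `[W_{n^{k+1}}^{(2^{k+1})}] ≲ [D_{n^{k+1}}] + n^{4(k+1)}`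
holds at infinitely many levels `n^{k+1}` (`2 ≤ n`), then every `φ ∈ X₄(F)` is BLIND to the thin edge
(`φ[W_n^{(2)}] = φ[D_n]`) or FLAT on the diamond (`φ[D_n] ≤ n⁴`): a seeing point has ratio `r > 1`, the
levels carry `r^{k+1}` against the fixed factor `2` of the dichotomy. [cite: Zuiddam2018, Thm. 2.12] -/
theorem blind_or_flat {n : ℕ} (hn : 2 ≤ n)
    (h : ∀ k₀ : ℕ, ∃ k : ℕ, k₀ ≤ k ∧
      AsympLe (fun x y : DTensorClass F 4 => x ≤ y)
        (DTensorClass.mk (sixTetra F (n ^ (k + 1)) (2 ^ (k + 1))))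
        (DTensorClass.mk (sixTetra F (n ^ (k + 1)) 1) + (((n ^ (k + 1)) ^ 4 : ℕ) : DTensorClass F 4)))
    {φ : DTensorClass F 4 → ℝ} (hφ : φ ∈ DTensorClass.asymptoticSpectrumDTensors F 2) :
    φ (DTensorClass.mk (sixTetra F n 2)) = φ (DTensorClass.mk (sixTetra F n 1)) ∨
      φ (DTensorClass.mk (sixTetra F n 1)) ≤ (n : ℝ) ^ 4 := by
  have hn1 : 1 ≤ n := by omega
  set a := φ (DTensorClass.mk (sixTetra F n 1)) with ha
  set w := φ (DTensorClass.mk (sixTetra F n 2)) with hw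
  have haw : a ≤ w := spectrum_diamond_le_sixTetra (F := F) (by norm_num) hφ
  by_cases heq : w = a
  · exact Or.inl heq
  right
  by_contra hflat
  rw [not_le] at hflat
  have ha1 : 1 ≤ a := one_le_spectrum_sixTetra (F := F) hn1 le_rfl hφ
  have ha0 : 0 < a := by linarith
  have hlt : a < w := lt_of_le_of_ne haw (Ne.symm heq)
  -- the ratio `r = w / a > 1`, written as `1 + η`
  set η : ℝ := w / a - 1 with hη
  have hη0 : 0 < η := by
    rw [hη, sub_pos, one_lt_div ha0]
    exact hlt
  have hwr : w = (1 + η) * a := by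
    rw [hη]
    field_simp
    ring
  -- pick a level with `(k+1) η > 1`
  obtain ⟨k, hk, hP⟩ := h ⌈1 / η⌉₊
  have hkη : 1 < (k + 1 : ℝ) * η := by
    have h1 : 1 / η ≤ (⌈1 / η⌉₊ : ℝ) := Nat.le_ceil _
    have h2 : (⌈1 / η⌉₊ : ℝ) ≤ k := by exact_mod_cast hk
    have h3 : 1 / η * η = 1 := by field_simp
    nlinarith
  have hpow : 2 < (1 + η) ^ (k + 1) := by
    have hb := one_add_mul_le_pow (by linarith : (-2 : ℝ) ≤ η) (k + 1)
    push_cast at hb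
    linarith
  -- read the purchase at level `n^{k+1}` at `φ`
  have hdich := flat_or_lt_two_mul_of_purchase hP hφ
  rw [← spectrum_sixTetra_pow (F := F) hn k hφ, ← hw] at hdich
  have hDpow : φ (DTensorClass.mk (sixTetra F (n ^ (k + 1)) 1)) = a ^ (k + 1) := by
    have := spectrum_sixTetra_pow (F := F) hn1 k hφ
    rw [one_pow] at this
    rw [← this]
  rw [hDpow] at hdich
  rcases hdich with hfl | hsee
  · -- flat at the power level contradicts `n⁴ < a`
    have : ((n : ℝ) ^ 4) ^ (k + 1) < a ^ (k + 1) := by gcongr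
    have h' : (((n ^ (k + 1)) ^ 4 : ℕ) : ℝ) = ((n : ℝ) ^ 4) ^ (k + 1) := by push_cast; ring
    linarith
  · -- seeing at the power level contradicts `r^{k+1} > 2`
    rw [hwr, mul_pow] at hsee
    have hapos : 0 < a ^ (k + 1) := pow_pos ha0 _
    have : (1 + η) ^ (k + 1) < 2 := lt_of_mul_lt_mul_right (by linarith) hapos.le
    linarith

/-- `2^{k+1} ≤ ⌈(n^{k+1})^δ⌉` as soon as `2 ≤ n^δ`. [folklore] -/
theorem two_pow_le_rectDim_pow {n : ℕ} {δ : ℝ} (h2 : (2 : ℝ) ≤ (n : ℝ) ^ δ) (k : ℕ) :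
    2 ^ (k + 1) ≤ rectDim (n ^ (k + 1)) δ := by
  have hn0 : (0 : ℝ) ≤ n := Nat.cast_nonneg n
  have key : ((2 ^ (k + 1) : ℕ) : ℝ) ≤ (((n ^ (k + 1) : ℕ) : ℝ)) ^ δ := by
    have : (((n ^ (k + 1) : ℕ) : ℝ)) ^ δ = ((n : ℝ) ^ δ) ^ (k + 1) := by
      push_cast
      rw [← Real.rpow_natCast (n : ℝ) (k + 1), ← Real.rpow_mul hn0, mul_comm, Real.rpow_mul hn0,
        Real.rpow_natCast]
    rw [this]
    push_cast
    gcongr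
  unfold rectDim
  exact_mod_cast key.trans (Nat.le_ceil _)

/-- **BLIND OR FLAT from the purchase of record**: `RUNG♭(δ, n^{k+1})` at infinitely many `k`
(`2 ≤ n^δ`, `2 ≤ n`; any `δ`) forces every `φ ∈ X₄(F)` to be blind to the thin edge or flat on the diamond — the
same conclusion for every `δ` of the window of record. [cite: Zuiddam2018, Thm. 2.12] -/
theorem blind_or_flat_of_flatPurchase {δ : ℝ} {n : ℕ} (hn : 2 ≤ n)
    (h2 : (2 : ℝ) ≤ (n : ℝ) ^ δ)
    (h : ∀ k₀ : ℕ, ∃ k : ℕ, k₀ ≤ k ∧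
      AsympLe (fun x y : DTensorClass F 4 => x ≤ y)
        (DTensorClass.mk (sixTetra F (n ^ (k + 1)) (rectDim (n ^ (k + 1)) δ)))
        (DTensorClass.mk (sixTetra F (n ^ (k + 1)) 1) + (((n ^ (k + 1)) ^ 4 : ℕ) : DTensorClass F 4)))
    {φ : DTensorClass F 4 → ℝ} (hφ : φ ∈ DTensorClass.asymptoticSpectrumDTensors F 2) :
    φ (DTensorClass.mk (sixTetra F n 2)) = φ (DTensorClass.mk (sixTetra F n 1)) ∨
      φ (DTensorClass.mk (sixTetra F n 1)) ≤ (n : ℝ) ^ 4 := by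
  have hSP : IsStrassenPreorder (fun x y : DTensorClass F 4 => x ≤ y) :=
    DTensorClass.isStrassenPreorder F 2
  refine blind_or_flat hn (fun k₀ => ?_) hφ
  obtain ⟨k, hk, hP⟩ := h k₀
  exact ⟨k, hk, hSP.asympLe_trans
    (hSP.asympLe_of_le (mk_sixTetra_mono (two_pow_le_rectDim_pow h2 k))) hP⟩

/-- **NEC anchor**: under `ω = 2` every point of `X₄(ℂ)` is blind to the thin edge or flat on the diamond,
at every level `n ≥ 2` (through `flatPurchase_of_matrixMultiplication` at `δ = 1`).
[cite: ChristandlVranaZuiddam2016, §1.1] -/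
theorem blind_or_flat_of_matrixMultiplication (hS : _root_.MatrixMultiplication) {n : ℕ} (hn : 2 ≤ n)
    {φ : DTensorClass ℂ 4 → ℝ} (hφ : φ ∈ DTensorClass.asymptoticSpectrumDTensors ℂ 2) :
    φ (DTensorClass.mk (sixTetra ℂ n 2)) = φ (DTensorClass.mk (sixTetra ℂ n 1)) ∨
      φ (DTensorClass.mk (sixTetra ℂ n 1)) ≤ (n : ℝ) ^ 4 := by
  refine blind_or_flat_of_flatPurchase (δ := 1) hn (by rw [Real.rpow_one]; exact_mod_cast hn)
    (fun k₀ => ⟨k₀, le_rfl, ?_⟩) hφ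
  have hN : 2 ≤ n ^ (k₀ + 1) := le_trans hn (Nat.le_self_pow (Nat.succ_ne_zero k₀) n)
  exact flatPurchase_of_matrixMultiplication hS le_rfl hN

/-- **THE KILL TEST OF RECORD, RE-TYPED.** One spectral point `φ ∈ X₄(F)` and one level `n ≥ 2` with
`φ[W_n^{(2)}] ≠ φ[D_n]` (the point sees the doubling of the thin edge) and `n⁴ < φ[D_n]` (the point values
the diamond above its largest flattening) refute the purchase of record `RUNG♭(δ, ·)` along the powers of `n`,
for every `δ` with `2 ≤ n^δ`. [cite: Zuiddam2018, Thm. 2.12] -/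
theorem not_flatPurchase_of_seeing_nonflat_point {δ : ℝ} {n : ℕ} (hn : 2 ≤ n)
    (h2 : (2 : ℝ) ≤ (n : ℝ) ^ δ) {φ : DTensorClass F 4 → ℝ}
    (hφ : φ ∈ DTensorClass.asymptoticSpectrumDTensors F 2)
    (hsee : φ (DTensorClass.mk (sixTetra F n 2)) ≠ φ (DTensorClass.mk (sixTetra F n 1)))
    (hnonflat : (n : ℝ) ^ 4 < φ (DTensorClass.mk (sixTetra F n 1))) :
    ¬ ∀ k₀ : ℕ, ∃ k : ℕ, k₀ ≤ k ∧
      AsympLe (fun x y : DTensorClass F 4 => x ≤ y)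
        (DTensorClass.mk (sixTetra F (n ^ (k + 1)) (rectDim (n ^ (k + 1)) δ)))
        (DTensorClass.mk (sixTetra F (n ^ (k + 1)) 1) + (((n ^ (k + 1)) ^ 4 : ℕ) : DTensorClass F 4)) := by
  intro h
  rcases blind_or_flat_of_flatPurchase hn h2 h hφ with hb | hf
  · exact hsee hb
  · exact absurd hf (not_le.mpr hnonflat)

end BlindOrFlat

end Summit.MatrixMultiplication.MatrixMultiplication.Theorems.EdgePencil

end
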